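import Mathlib
import Literature.AlgebraicGeometry.Tropical.TorusCycles
import Summits.HodgeConjecture.HodgeConjecture.Theorems.TropicalKugaSatakeCayleyFormalCycleCriterionFormalFamilyLinAlg
import Summits.HodgeConjecture.HodgeConjecture.Theorems.TropicalWeilObstructionTropicalWeilVanishingFlatObstructionLinAlg
import HarnessLib

/-!
# Crux `TropicalWeilVanishing` (stmt-HodgeConjecture-18478), line `identity_transfer` — generic
# solvability of rational linear systems along the Weil period domain (for `stub_transportToIdentity`)

Route `TropicalWeilObstruction` of `HodgeConjecture`. The GENERIC SPREAD step of the isogeny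
transport (Zharkov 2020, p. 3: "the vertices of the cycles vary rationally over the space of
parameters") rests on two facts proved here:

* `mulVec_section_of_generic`, `exists_linear_section` — RATIONAL SOLVABILITY PROPAGATES ALONG A
  `ℚ`-GENERIC POINT OF A SET: if the real system `Φ u = Ψ t` (`Φ`, `Ψ` real-linear maps between
  coordinate spaces taking rational vectors to rational vectors) is solvable at a parameter `t₀`
  such that every rational linear form vanishing at `t₀` vanishes on the whole set `S`, then there
  is ONE real-linear `G` with `Φ (G (Ψ t)) = Ψ t` for every `t ∈ S` (generalized inverse of the
  rational matrix of `Φ`; the obstruction rows are rational forms killing `t₀`);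
* `exists_signedFreeEntry`, `weilGeneric_linear_forms` — for the Weil period domain
  `Sym_J = {P symmetric, P J = J P}` (`J = weilJ n`): every entry of `P ∈ Sym_J` is `0` or `±` one of
  the `n²` free coordinates (`P_{a+n,b+n}`, `a ≤ b`; `P_{b,a+n}`, `b < a`), so a rational linear form in
  the entries that vanishes at a period `Q ∈ Sym_J` with algebraically independent free coordinates
  (`IsWeilGeneric`) vanishes identically on `Sym_J`.

Mathlib + tree lemmas (`FormalCycleCriterion.exists_generalizedInverse`, the `weilJ` entry lemmas);
no definition, no named fact, no sorry.

## References

* [Zharkov2020TropicalWeil] I. Zharkov, Tropical abelian varieties, Weil classes and the Hodge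
  conjecture, arXiv:2002.02347 (2020), §2 (pp. 2–4).
* [MikhalkinZharkov2014Eigenwave] G. Mikhalkin, I. Zharkov, Tropical eigenwave and intermediate
  Jacobians, LN UMI 15 (2014), Def. 4.2, Def. 6.1.
-/

-- `Summit.HodgeConjecture.HodgeConjecture.…` is the mandated namespace (single-conjunct summit).
set_option linter.dupNamespace false

noncomputable section

open scoped BigOperators Matrix
open Matrix Literature.AlgebraicGeometry.Tropical

namespace Summit.HodgeConjecture.HodgeConjecture.Theorems.TropicalWeilVanishing

/-! ### Rational solvability propagates along a `ℚ`-generic point of a set -/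

section Generic

variable {ι κ μ : Type*} [Fintype ι] [Fintype κ] [Fintype μ] [DecidableEq ι] [DecidableEq κ]
  [DecidableEq μ]

omit [DecidableEq ι] [DecidableEq κ] [DecidableEq μ] in
/-- **Matrix form.** `M`, `N` rational, `G` a generalized inverse of `M`, `M x₀ = N t₀`, and every
rational linear form killing `t₀` kills all of `S`: then `M (G (N t)) = N t` for every `t ∈ S`.
[cite: Zharkov2020TropicalWeil, §2 (p. 3)] -/
theorem mulVec_section_of_generic (M : Matrix μ κ ℚ) (G : Matrix κ μ ℚ) (hG : M * G * M = M)
    (N : Matrix μ ι ℚ) (t₀ : ι → ℝ) (S : Set (ι → ℝ))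
    (hgen : ∀ r : ι → ℚ, ∑ i, (r i : ℝ) * t₀ i = 0 → ∀ t ∈ S, ∑ i, (r i : ℝ) * t i = 0)
    (x₀ : κ → ℝ) (hx₀ : (M.map ((↑) : ℚ → ℝ)) *ᵥ x₀ = (N.map ((↑) : ℚ → ℝ)) *ᵥ t₀)
    (t : ι → ℝ) (ht : t ∈ S) :
    (M.map ((↑) : ℚ → ℝ)) *ᵥ ((G.map ((↑) : ℚ → ℝ)) *ᵥ ((N.map ((↑) : ℚ → ℝ)) *ᵥ t)) =
      (N.map ((↑) : ℚ → ℝ)) *ᵥ t := by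
  -- every row of the rational obstruction `M G N - N` kills `t₀`, hence kills `t`
  have hrow : ∀ m : μ, ∑ i, ((M * G * N - N) m i : ℝ) * t i = 0 := by
    intro m
    refine hgen _ ?_ t ht
    have e : ((M * G * N - N).map ((↑) : ℚ → ℝ)) *ᵥ t₀ = 0 := by
      rw [Matrix.map_sub ((↑) : ℚ → ℝ) Rat.cast_sub, FormalCycleCriterion.map_ratCast_mul,
        FormalCycleCriterion.map_ratCast_mul,
        Matrix.sub_mulVec, ← Matrix.mulVec_mulVec, ← Matrix.mulVec_mulVec, ← hx₀,
        Matrix.mulVec_mulVec, Matrix.mulVec_mulVec, ← FormalCycleCriterion.map_ratCast_mul,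
        ← FormalCycleCriterion.map_ratCast_mul, hG,
        sub_self]
    have := congrFun e m
    simpa [Matrix.mulVec, dotProduct, Matrix.map_apply] using this
  have key : ((M * G * N - N).map ((↑) : ℚ → ℝ)) *ᵥ t = 0 := by
    funext m
    simpa [Matrix.mulVec, dotProduct, Matrix.map_apply] using hrow m
  rw [Matrix.map_sub ((↑) : ℚ → ℝ) Rat.cast_sub, FormalCycleCriterion.map_ratCast_mul,
    FormalCycleCriterion.map_ratCast_mul,
    Matrix.sub_mulVec, sub_eq_zero, ← Matrix.mulVec_mulVec, ← Matrix.mulVec_mulVec] at key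
  exact key

/-- **Linear-map form.** Real-linear maps `Φ : ℝ^κ → ℝ^μ`, `Ψ : ℝ^ι → ℝ^μ` taking rational
vectors to rational vectors, a solution `Φ u₀ = Ψ t₀` at a parameter `t₀` generic for the set `S`
(every rational linear form vanishing at `t₀` vanishes on `S`): then some real-linear `G` solves
`Φ (G (Ψ t)) = Ψ t` simultaneously for all `t ∈ S`. [cite: Zharkov2020TropicalWeil, §2 (p. 3)] -/
theorem exists_linear_section (Φ : (κ → ℝ) →ₗ[ℝ] (μ → ℝ)) (Ψ : (ι → ℝ) →ₗ[ℝ] (μ → ℝ))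
    (hΦ : ∀ u : κ → ℚ, ∃ y : μ → ℚ, Φ (fun k => (u k : ℝ)) = fun m => (y m : ℝ))
    (hΨ : ∀ s : ι → ℚ, ∃ y : μ → ℚ, Ψ (fun i => (s i : ℝ)) = fun m => (y m : ℝ))
    (t₀ : ι → ℝ) (S : Set (ι → ℝ))
    (hgen : ∀ r : ι → ℚ, ∑ i, (r i : ℝ) * t₀ i = 0 → ∀ t ∈ S, ∑ i, (r i : ℝ) * t i = 0)
    (u₀ : κ → ℝ) (hu₀ : Φ u₀ = Ψ t₀) :
    ∃ G : (μ → ℝ) →ₗ[ℝ] (κ → ℝ), ∀ t ∈ S, Φ (G (Ψ t)) = Ψ t := by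
  classical
  -- the matrices of `Φ`, `Ψ` are rational
  choose yΦ hyΦ using hΦ
  choose yΨ hyΨ using hΨ
  set Mq : Matrix μ κ ℚ := Matrix.of fun m k => yΦ (Pi.single k 1) m with hMq
  set Nq : Matrix μ ι ℚ := Matrix.of fun m i => yΨ (Pi.single i 1) m with hNq
  have hM : LinearMap.toMatrix' Φ = Mq.map ((↑) : ℚ → ℝ) := by
    ext m k
    rw [LinearMap.toMatrix'_apply]
    have e : (Pi.single k 1 : κ → ℝ) = fun k' => ((Pi.single k (1 : ℚ) : κ → ℚ) k' : ℝ) := by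
      funext k'; by_cases h : k' = k
      · subst h; simp
      · simp [h]
    rw [e, hyΦ]
    simp [hMq]
  have hN : LinearMap.toMatrix' Ψ = Nq.map ((↑) : ℚ → ℝ) := by
    ext m i
    rw [LinearMap.toMatrix'_apply]
    have e : (Pi.single i 1 : ι → ℝ) = fun i' => ((Pi.single i (1 : ℚ) : ι → ℚ) i' : ℝ) := by
      funext i'; by_cases h : i' = i
      · subst h; simp
      · simp [h]
    rw [e, hyΨ]
    simp [hNq]
  have hΦv : ∀ v, Φ v = (Mq.map ((↑) : ℚ → ℝ)) *ᵥ v := by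
    intro v
    rw [← hM, ← Matrix.toLin'_apply, Matrix.toLin'_toMatrix']
  have hΨv : ∀ v, Ψ v = (Nq.map ((↑) : ℚ → ℝ)) *ᵥ v := by
    intro v
    rw [← hN, ← Matrix.toLin'_apply, Matrix.toLin'_toMatrix']
  obtain ⟨Gq, hGq⟩ := FormalCycleCriterion.exists_generalizedInverse Mq
  refine ⟨Matrix.toLin' (Gq.map ((↑) : ℚ → ℝ)), fun t ht => ?_⟩
  rw [hΦv, hΨv, Matrix.toLin'_apply]
  exact mulVec_section_of_generic Mq Gq hGq Nq t₀ S hgen u₀ (by rw [← hΦv, ← hΨv, hu₀]) t ht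

end Generic

/-! ### The Weil period domain: entries are signed free coordinates; generic linear forms -/

section Weil

variable {n : ℕ}

/-- `P_{a, b+n} = -P_{a+n, b}` (`a, b < n`) for `P` commuting with `J = weilJ n`. [folklore] -/
theorem apply_lo_hi_of_commute {P : Matrix (Fin (2 * n)) (Fin (2 * n)) ℝ}
    (hJ : P * weilJ n = weilJ n * P) (a b : Fin n) :
    P ⟨(a : ℕ), by omega⟩ ⟨(b : ℕ) + n, by omega⟩ = -P ⟨(a : ℕ) + n, by omega⟩ ⟨(b : ℕ), by omega⟩ := by
  have e1 := TropicalWeilSupply.Negative.mul_weilJ_apply_left P ⟨(a : ℕ), by omega⟩ b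
  have e2 : (weilJ n * P) ⟨(a : ℕ), by omega⟩ ⟨(b : ℕ), by omega⟩ = -P ⟨(a : ℕ) + n, by omega⟩ ⟨(b : ℕ), by omega⟩ := by
    have := weilJ_mulVec_apply_lo (fun c => P c ⟨(b : ℕ), by omega⟩) a
    simpa [Matrix.mul_apply, Matrix.mulVec, dotProduct] using this
  rw [hJ, e2] at e1
  exact e1.symm

/-- `P_{a, a+n} = 0` (`a < n`) for symmetric `P` commuting with `J`. [folklore] -/
theorem apply_lo_hi_self_of_commute {P : Matrix (Fin (2 * n)) (Fin (2 * n)) ℝ} (hS : P.IsSymm)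
    (hJ : P * weilJ n = weilJ n * P) (a : Fin n) :
    P ⟨(a : ℕ), by omega⟩ ⟨(a : ℕ) + n, by omega⟩ = 0 := by
  have h1 := apply_lo_hi_of_commute hJ a a
  have h2 := hS.apply ⟨(a : ℕ), by omega⟩ ⟨(a : ℕ) + n, by omega⟩
  linarith

/-- **Every entry of a symmetric `J`-commuting `P` is a signed free coordinate.** There are maps
`φ : (a, b) ↦ (c, d) ∈ Fin n × Fin n` and signs `E (a, b) ∈ {0, ±1}`, the same for all `P`, with
`P_{ab} = E(a,b) · x_P(φ(a,b))`, where the free coordinates of `P = [[A, B], [-B, A]]`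
(`A` symmetric, `B` antisymmetric) are `x_P(c, d) = P_{c+n, d+n}` for `c ≤ d` and
`x_P(c, d) = P_{d, c+n}` for `d < c` (the coordinates `WeilFamily.Polarization.coord`).
[cite: Zharkov2020TropicalWeil, §2 (pp. 2–4)] -/
theorem exists_signedFreeEntry (n : ℕ) :
    ∃ (φ : Fin (2 * n) → Fin (2 * n) → Fin n × Fin n) (E : Fin (2 * n) → Fin (2 * n) → ℤ),
      ∀ P : Matrix (Fin (2 * n)) (Fin (2 * n)) ℝ, P.IsSymm → P * weilJ n = weilJ n * P →
        ∀ a b : Fin (2 * n), P a b = (E a b : ℝ) *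
          (if (φ a b).1 ≤ (φ a b).2 then
              P ⟨((φ a b).1 : ℕ) + n, by omega⟩ ⟨((φ a b).2 : ℕ) + n, by omega⟩
            else P ⟨((φ a b).2 : ℕ), by omega⟩ ⟨((φ a b).1 : ℕ) + n, by omega⟩) := by
  -- the position inside the block: `lo ⟨i⟩ = lo ⟨i + n⟩ = i`
  let lo : Fin (2 * n) → Fin n := fun a => ⟨(a : ℕ) % n, Nat.mod_lt _ (by have := a.isLt; omega)⟩
  have lo1 : ∀ i : Fin n, lo ⟨(i : ℕ), by omega⟩ = i := fun i =>
    Fin.ext (by simp [lo, Nat.mod_eq_of_lt i.isLt])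
  have lo2 : ∀ i : Fin n, lo ⟨(i : ℕ) + n, by omega⟩ = i := fun i =>
    Fin.ext (by simp [lo, Nat.mod_eq_of_lt i.isLt])
  refine ⟨fun a b => if ((a : ℕ) < n ↔ (b : ℕ) < n) then (min (lo a) (lo b), max (lo a) (lo b))
      else (max (lo a) (lo b), min (lo a) (lo b)),
    fun a b => if ((a : ℕ) < n ↔ (b : ℕ) < n) then 1
      else if (a : ℕ) < n then (if lo a < lo b then 1 else if lo b < lo a then -1 else 0)
      else (if lo b < lo a then 1 else if lo a < lo b then -1 else 0), ?_⟩
  intro P hS hJ a b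
  have blk1 := fun c d : Fin n => TropicalWeilSupply.Negative.apply_add_add_of_commute hJ c d
  have blk2 := fun c d : Fin n => apply_lo_hi_of_commute hJ c d
  have zer := fun c : Fin n => apply_lo_hi_self_of_commute hS hJ c
  rcases fin_two_mul_cases a with ⟨i, rfl⟩ | ⟨i, rfl⟩ <;>
    rcases fin_two_mul_cases b with ⟨j, rfl⟩ | ⟨j, rfl⟩
  · -- block `A` (top left): `P_{ij} = P_{i+n, j+n}`
    have hc : (((⟨(i : ℕ), by omega⟩ : Fin (2 * n)) : ℕ) < n ↔ ((⟨(j : ℕ), by omega⟩ : Fin (2 * n)) : ℕ) < n) :=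
      ⟨fun _ => j.isLt, fun _ => i.isLt⟩
    simp only [if_pos hc, lo1, Int.cast_one, one_mul]
    rcases le_or_gt i j with h | h
    · simp only [min_eq_left h, max_eq_right h, if_pos h]
      rw [blk1]
    · simp only [min_eq_right h.le, max_eq_left h.le, if_pos h.le]
      rw [blk1, hS.apply]
  · -- block `B` (top right): `P_{i, j+n}`
    have hc : ¬ ((((⟨(i : ℕ), by omega⟩ : Fin (2 * n)) : ℕ) < n ↔ ((⟨(j : ℕ) + n, by omega⟩ : Fin (2 * n)) : ℕ) < n)) := by
      simp [i.isLt]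
    have ha : (((⟨(i : ℕ), by omega⟩ : Fin (2 * n)) : ℕ) < n) := i.isLt
    simp only [if_neg hc, if_pos ha, lo1, lo2]
    rcases lt_trichotomy i j with h | h | h
    · simp only [if_pos h, max_eq_right h.le, min_eq_left h.le, if_neg (not_le.2 h), Int.cast_one,
        one_mul]
    · subst h
      simp only [lt_irrefl, if_false, Int.cast_zero, zero_mul]
      exact zer i
    · simp only [if_neg (lt_asymm h), if_pos h, max_eq_left h.le, min_eq_right h.le,
        if_neg (not_le.2 h), Int.cast_neg, Int.cast_one, neg_mul, one_mul]
      rw [blk2, hS.apply]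
  · -- block `-B` (bottom left): `P_{i+n, j} = P_{j, i+n}`
    have hc : ¬ ((((⟨(i : ℕ) + n, by omega⟩ : Fin (2 * n)) : ℕ) < n ↔ ((⟨(j : ℕ), by omega⟩ : Fin (2 * n)) : ℕ) < n)) := by
      simp [j.isLt]
    have ha : ¬ (((⟨(i : ℕ) + n, by omega⟩ : Fin (2 * n)) : ℕ) < n) := by simp
    simp only [if_neg hc, if_neg ha, lo1, lo2]
    rcases lt_trichotomy i j with h | h | h
    · simp only [if_neg (lt_asymm h), if_pos h, max_eq_right h.le, min_eq_left h.le,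
        if_neg (not_le.2 h), Int.cast_neg, Int.cast_one, neg_mul, one_mul]
      rw [← hS.apply, blk2, hS.apply]
    · subst h
      simp only [lt_irrefl, if_false, Int.cast_zero, zero_mul]
      rw [← hS.apply]
      exact zer i
    · simp only [if_pos h, max_eq_left h.le, min_eq_right h.le, if_neg (not_le.2 h), Int.cast_one,
        one_mul]
      rw [hS.apply]
  · -- block `A` (bottom right)
    have hc : (((⟨(i : ℕ) + n, by omega⟩ : Fin (2 * n)) : ℕ) < n ↔ ((⟨(j : ℕ) + n, by omega⟩ : Fin (2 * n)) : ℕ) < n) := by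
      simp
    simp only [if_pos hc, lo2, Int.cast_one, one_mul]
    rcases le_or_gt i j with h | h
    · simp only [min_eq_left h, max_eq_right h, if_pos h]
    · simp only [min_eq_right h.le, max_eq_left h.le, if_pos h.le]
      rw [hS.apply]

/-- **Rational linear relations among the entries of a Weil-generic period hold on the whole Weil
period domain.** If `Q` is symmetric, commutes with `J`, and its `n²` free coordinates are
algebraically independent over `ℚ` (`IsWeilGeneric`), then every rational linear form in the
matrix entries vanishing at `Q` vanishes at every symmetric `J`-commuting `P`.
[cite: Zharkov2020TropicalWeil, §2 (pp. 2–4)] -/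
theorem weilGeneric_linear_forms {Q : Matrix (Fin (2 * n)) (Fin (2 * n)) ℝ} (hQ : Q.PosDef)
    (hQJ : Q * weilJ n = weilJ n * Q) (hgen : IsWeilGeneric n Q)
    (c : Fin (2 * n) × Fin (2 * n) → ℚ) (hc : ∑ ab, (c ab : ℝ) * Q ab.1 ab.2 = 0)
    (P : Matrix (Fin (2 * n)) (Fin (2 * n)) ℝ) (hS : P.IsSymm) (hJ : P * weilJ n = weilJ n * P) :
    ∑ ab, (c ab : ℝ) * P ab.1 ab.2 = 0 := by
  classical
  obtain ⟨φ, E, hφ⟩ := exists_signedFreeEntry n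
  have hQS : Q.IsSymm := by
    have h := hQ.1
    rw [Matrix.IsHermitian, Matrix.conjTranspose_eq_transpose_of_trivial] at h
    exact h
  -- the free coordinates of a matrix
  let x : Matrix (Fin (2 * n)) (Fin (2 * n)) ℝ → Fin n × Fin n → ℝ := fun P f =>
    if f.1 ≤ f.2 then P ⟨(f.1 : ℕ) + n, by omega⟩ ⟨(f.2 : ℕ) + n, by omega⟩
    else P ⟨(f.2 : ℕ), by omega⟩ ⟨(f.1 : ℕ) + n, by omega⟩
  -- regrouped coefficients
  let d : Fin n × Fin n → ℚ := fun f => ∑ ab, if φ ab.1 ab.2 = f then c ab * E ab.1 ab.2 else 0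
  have regroup : ∀ P : Matrix (Fin (2 * n)) (Fin (2 * n)) ℝ, P.IsSymm → P * weilJ n = weilJ n * P →
      ∑ ab, (c ab : ℝ) * P ab.1 ab.2 = ∑ f, (d f : ℝ) * x P f := by
    intro P hS hJ
    have step : ∀ ab : Fin (2 * n) × Fin (2 * n), (c ab : ℝ) * P ab.1 ab.2 =
        ∑ f, (if φ ab.1 ab.2 = f then ((c ab * E ab.1 ab.2 : ℚ) : ℝ) else 0) * x P f := by
      intro ab
      rw [Finset.sum_eq_single (φ ab.1 ab.2)]
      · rw [if_pos rfl, hφ P hS hJ ab.1 ab.2]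
        push_cast
        ring
      · intro f _ hf; rw [if_neg (Ne.symm hf), zero_mul]
      · intro h; exact absurd (Finset.mem_univ _) h
    simp_rw [step]
    rw [Finset.sum_comm]
    refine Finset.sum_congr rfl fun f _ => ?_
    rw [← Finset.sum_mul]
    congr 1
    push_cast [d]
    refine Finset.sum_congr rfl fun ab _ => ?_
    split_ifs <;> simp
  -- at the generic `Q` the regrouped form vanishes coefficientwise
  have hlin : LinearIndependent ℚ (x Q) := by
    have h := (TropicalWeilSupply.Negative.isVeryGeneral_of_isWeilGeneric hQ hQJ hgen).linearIndependent
    exact h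
  have hd : ∀ f, d f = 0 := by
    have h0 : ∑ f, d f • x Q f = 0 := by
      have := regroup Q hQS hQJ
      rw [hc] at this
      rw [this]
      exact Finset.sum_congr rfl fun f _ => Rat.smul_def _ _
    exact Fintype.linearIndependent_iff.1 hlin d h0
  rw [regroup P hS hJ]
  simp [hd]

end Weil

end Summit.HodgeConjecture.HodgeConjecture.Theorems.TropicalWeilVanishing

end
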